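import Literature.AlgebraicGeometry.Resolution.WeightedCentreTheoremFPrime
import Literature.AlgebraicGeometry.Resolution.WeightedCentreLeadingFlow
import Literature.AlgebraicGeometry.Resolution.WeightedCentreGenericWeight
import Literature.AlgebraicGeometry.Resolution.WeightedCentreLeadingMonomial
import Literature.AlgebraicGeometry.Resolution.WeightedCentreLemmaXL
import Mathlib.Algebra.MvPolynomial.Division
import HarnessLib

/-!
# Step (L1′) of engine 1's `W(f)` toy model: the DERIVED tailed light flow on the face `h|_{Z″=0}`, and THEOREM 𝔉′ assembled
# unconditionally (an instrument for the toy model — NOT a resolution theorem)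

RE-DERIVATION-eng1-g44 §3.3 / CARVER-NOTES-eng1-g45 §1–§3, step (L1′).  Let `(𝔇, q)` be a tailed light flow of unit `θ` on a menu
`G` (`IsTailedLightFlow`: `G(Φ(T)ε) = G` for `Φ(T) : ε_i ↦ Σ_{b<p} u_b 𝔇^b(ε_i) T^b + q_i T^p`), let `c ≤ p` be a threshold below
which `𝔇` vanishes, and let `Z″ := {j : w_j < c}`.  THE DERIVED FLOW (`exists_derived_flow`): the face `G|_{Z″=0} = killLight (c ≤ w ·) G`
carries a tailed light flow of some unit whose derivation is SUPPORTED ABOVE `c` (vanishes on `Z″`, data free of `Z″`-variables).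
Construction, as in the engine's notes:
* a GENERIC positive integral weight `λ'` (`GenericWeight.exists_generic_weight`) on the `Z″`-parts `zpart` of the exponents of
  the data and tails, read as the `ℚ`-weight `λ := lamZ` (`λ'` on `Z″`, `0` elsewhere); the LEVEL `μ :=` the least value among the
  `λ'`-weights of the `Z″`-parts of the data and `1/p ×` those of the tails; then every datum weighs `≥ λ_i + μ`, every tail
  `≥ λ_i + pμ`, and the tree's leading-form principle (★′) (`substC_lead_component_zero`) says that the LEADING data
  `(𝔇_λ, q_λ) = (FilteredDerivation.lead, leadTail)` fix the `λ`-weight-`0` component of `G`, which is the face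
  (`weightedHomogeneousComponent_zero_eq_killLight`);
* CASE (I), `𝔇_λ ≠ 0`: by genericity every monomial of every `𝔇_λ ε_i` has the SAME `Z″`-part `γ₀` and every monomial of every
  `q_{λ,i}` the `Z″`-part `p • γ₀`; dividing by `ε^{γ₀}` (Mathlib `MvPolynomial.divMonomial`) gives data `(𝔇₂, q₂)` free of `Z″`
  with `𝔇_λ^b = ε^{bγ₀} 𝔇₂^b` (`LeadingMonomial.iterate_eq_monomial_pow_mul_iterate`, L9 (iii)), so `Φ_λ(T) = Φ₂(ε^{γ₀} T)` and the
  substitution `T ↦ ε^{γ₀} T` is cancelled (`comp_C_mul_X_injective`): `(𝔇₂, q₂)` is a tailed light flow of unit `θ + ⟨w, γ₀⟩`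
  on the face (`exists_derived_flow_of_lead_ne_zero`);
* CASE (II), `𝔇_λ = 0`: the leading tails alone give the PURE-TAIL flow `(0, q_λ)` of unit `θ` on the face
  (`exists_derived_flow_of_lead_eq_zero`).
Specialised to faces this is exactly the typed output statement `DerivedFaceStep p u w h` of the tree's THEOREM 𝔉′ frame
(`derivedFaceStep`), whence **THEOREM 𝔉′ UNCONDITIONALLY in the toy model** (`noTailedLightFlow`): under `b!·u_b = 1 (b < p)`,
`1 < p`, positive weights and the pin condition (P) at every slot of weight `≤ p + 1`, a menu carries NO tailed light flow of any unit
(`noTailedLightFlow_of_derivedFaceStep` of the tree does the induction; (H′), (L0′) are the tree's).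

HONEST FRAMING.  Graded commutative algebra of derivations on a weighted polynomial ring over a field ([Matsumura1987, §25, §27
(pp. 207–209)]: derivations, truncated exponentials; [Lang2002, Ch. IV §1]: substitutions, weighted gradings, leading forms;
[GreuelPfister2002, Lemma 1.2.11, Example 1.2.12]: generic weights separating finitely many monomials; faces / graded coordinate
changes in the sense of [AbramovichTemkinWlodarczyk2024, §5.1 (p. 1575), Thm. 5.3.1 (2)-(3) (p. 1578)]).  Statements are engine 1's
(cell `pub-rosobs`), the formalisation OURS; everything here is an instrument for the cell's `W(f)` TOY MODEL — NOT a resolution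
theorem, NOT a statement about the invariant of [AbramovichTemkinWlodarczyk2024], NOT summit progress.  (Re-typed by carver-g66 after
carver-g65's version bounced on a duplicated bookkeeping lemma; `LemmaXL.weight_nonneg` is reused.)
-/

namespace Literature.AlgebraicGeometry.Resolution.WeightedBlowup

namespace TailedLightFlow

open MvPolynomial LeadingForm FilteredDerivation

/-! ## 1. `Z`-parts of exponents and the `Z`-restricted weight -/

section ZPart

variable {ι : Type*} (Z : ι → Prop) [DecidablePred Z]

/-- The `Z`-PART of an exponent vector: its restriction to the slots of `Z` (engine: the `Z″`-part `γ` of a monomial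
`ε^γ · (Z″-free)`; construction = `Finsupp.filter`). [cite: GreuelPfister2002, Lemma 1.2.11] -/
def zpart (d : ι →₀ ℕ) : ι →₀ ℕ := d.filter Z

/-- Bookkeeping. [cite: GreuelPfister2002, Lemma 1.2.11] -/
theorem zpart_apply (d : ι →₀ ℕ) (i : ι) : zpart Z d i = if Z i then d i else 0 := Finsupp.filter_apply _ _ _

/-- Bookkeeping. [cite: GreuelPfister2002, Lemma 1.2.11] -/
theorem mem_support_zpart {d : ι →₀ ℕ} {i : ι} : i ∈ (zpart Z d).support ↔ i ∈ d.support ∧ Z i := by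
  rw [zpart, Finsupp.support_filter, Finset.mem_filter]

/-- Bookkeeping: the `Z`-part divides. [cite: GreuelPfister2002, Lemma 1.2.11] -/
theorem zpart_le (d : ι →₀ ℕ) : zpart Z d ≤ d := fun i => by
  rw [zpart_apply]
  split_ifs
  · exact le_rfl
  · exact Nat.zero_le _

/-- Bookkeeping: the `Z`-part is additive. [cite: GreuelPfister2002, Lemma 1.2.11] -/
theorem zpart_add (d e : ι →₀ ℕ) : zpart Z (d + e) = zpart Z d + zpart Z e := Finsupp.filter_add

/-- Bookkeeping: an exponent supported on `Z` is its own `Z`-part. [cite: GreuelPfister2002, Lemma 1.2.11] -/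
theorem zpart_eq_self {d : ι →₀ ℕ} (hd : ∀ i ∈ d.support, Z i) : zpart Z d = d :=
  (Finsupp.filter_eq_self_iff Z d).mpr fun i hi => hd i (Finsupp.mem_support_iff.mpr hi)

/-- Bookkeeping: an exponent with zero `Z`-part avoids `Z`. [cite: GreuelPfister2002, Lemma 1.2.11] -/
theorem not_of_zpart_eq_zero {d : ι →₀ ℕ} (hd : zpart Z d = 0) {i : ι} (hi : i ∈ d.support) : ¬ Z i :=
  fun hZ => Finsupp.mem_support_iff.mp hi ((Finsupp.filter_eq_zero_iff Z d).mp hd i hZ)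

variable (lam' : ι → ℕ)

/-- The `Z`-RESTRICTED rational weight `λ`: `λ' ` on `Z`, `0` elsewhere (engine: "`λ` generic positive on `Z″`, `0` on the
rest"; construction). [cite: GreuelPfister2002, Example 1.2.12] -/
def lamZ : ι → ℚ := fun i => if Z i then (lam' i : ℚ) else 0

/-- Bookkeeping. [cite: GreuelPfister2002, Example 1.2.12] -/
theorem lamZ_nonneg (i : ι) : 0 ≤ lamZ Z lam' i := by
  rw [lamZ]
  split_ifs
  · exact Nat.cast_nonneg _
  · exact le_rfl

/-- Bookkeeping. [cite: GreuelPfister2002, Example 1.2.12] -/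
theorem lamZ_of_not {i : ι} (hi : ¬ Z i) : lamZ Z lam' i = 0 := if_neg hi

/-- With `λ'` positive, `λ_i = 0` exactly off `Z` (bookkeeping). [cite: GreuelPfister2002, Example 1.2.12] -/
theorem lamZ_eq_zero_iff (hpos : ∀ i, 0 < lam' i) (i : ι) : lamZ Z lam' i = 0 ↔ ¬ Z i := by
  rw [lamZ]
  split_ifs with h
  · simp only [Nat.cast_eq_zero, (hpos i).ne', h, not_true_eq_false]
  · simp only [h, not_false_eq_true]

/-- **The `λ`-weight of a monomial is the `λ'`-weight of its `Z`-part** (bookkeeping). [cite: GreuelPfister2002, Example 1.2.12] -/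
theorem weight_lamZ (d : ι →₀ ℕ) : Finsupp.weight (lamZ Z lam') d = ((Finsupp.weight lam' (zpart Z d) : ℕ) : ℚ) := by
  have h1 : (Finsupp.weight lam' (zpart Z d) : ℕ) = ∑ i ∈ d.support, zpart Z d i • lam' i := by
    rw [Finsupp.weight_apply, Finsupp.sum]
    exact Finset.sum_subset (Finsupp.support_mono (zpart_le Z d)) fun i _ hi => by
      rw [Finsupp.notMem_support_iff.mp hi, zero_smul]
  rw [h1, Finsupp.weight_apply, Finsupp.sum, Nat.cast_sum]
  refine Finset.sum_congr rfl fun i _ => ?_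
  rw [zpart_apply, lamZ]
  split_ifs with h <;> simp

end ZPart

/-! ## 2. Generic bookkeeping: weight-`0` components as faces, components and monomial quotients of homogeneous polynomials -/

section Generic

variable {k : Type*} [CommRing k] {ι : Type*}

/-- **The `λ`-weight-`0` component of `G` is the face of `G`** killing the slots where `λ > 0` (for `λ ≥ 0`; engine:
"`comp^λ_0(h) = h|_{Z″=0}`"; bookkeeping). [cite: Lang2002, Ch. IV §1] [cite: AbramovichTemkinWlodarczyk2024, §5.1 (p. 1575)] -/
theorem weightedHomogeneousComponent_zero_eq_killLight (lam : ι → ℚ) (hlam : ∀ i, 0 ≤ lam i) (H : ι → Prop)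
    [DecidablePred H] (hH : ∀ i, H i ↔ lam i = 0) (P : MvPolynomial ι k) :
    weightedHomogeneousComponent lam 0 P = killLight H P := by
  classical
  ext t
  rw [coeff_weightedHomogeneousComponent, coeff_killLight]
  by_cases ht : IsHeavy H t
  · rw [if_pos ht, if_pos]
    rw [Finsupp.weight_apply, Finsupp.sum]
    exact Finset.sum_eq_zero fun i hi => by rw [(hH i).mp (ht i hi), smul_zero]
  · rw [if_neg ht, if_neg]
    intro h0
    exact ht fun i hi => (hH i).mpr (LemmaL.weight_eq_zero_of_nonneg hlam h0 hi)

/-- A component of a polynomial involves only its variables (bookkeeping). [cite: Lang2002, Ch. IV §1] -/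
theorem vars_weightedHomogeneousComponent_subset [DecidableEq ι] (lam : ι → ℚ) (m : ℚ) (P : MvPolynomial ι k) :
    (weightedHomogeneousComponent lam m P).vars ⊆ P.vars := by
  classical
  intro j hj
  obtain ⟨d, hd, hjd⟩ := (mem_vars_iff_mem_support j).mp hj
  refine (mem_vars_iff_mem_support j).mpr ⟨d, ?_, hjd⟩
  rw [mem_support_iff, coeff_weightedHomogeneousComponent] at hd
  split_ifs at hd with h
  · exact mem_support_iff.mpr hd
  · exact absurd rfl hd

/-- A `λ`-component of a `w`-homogeneous polynomial is `w`-homogeneous of the same weight (bookkeeping). [cite: Lang2002, Ch. IV §1] -/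
theorem isWeightedHomogeneous_weightedHomogeneousComponent_of {w lam : ι → ℚ} {P : MvPolynomial ι k} {n : ℚ}
    (hP : IsWeightedHomogeneous w P n) (m : ℚ) : IsWeightedHomogeneous w (weightedHomogeneousComponent lam m P) n := by
  classical
  intro d hd
  rw [coeff_weightedHomogeneousComponent] at hd
  split_ifs at hd with h
  · exact hP hd
  · exact absurd rfl hd

/-- **A polynomial all of whose monomials are divisible by `ε^s` is `ε^s` times its monomial quotient** (bookkeeping over Mathlib's
`divMonomial`/`modMonomial`). [cite: Lang2002, Ch. IV §1] -/
theorem eq_monomial_mul_divMonomial {P : MvPolynomial ι k} {s : ι →₀ ℕ} (h : ∀ d ∈ P.support, s ≤ d) :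
    P = monomial s 1 * P.divMonomial s := by
  have hmod : P.modMonomial s = 0 := by
    ext d
    rw [coeff_zero]
    by_cases hsd : s ≤ d
    · exact coeff_modMonomial_of_le P hsd
    · rw [coeff_modMonomial_of_not_le P hsd]
      exact notMem_support_iff.mp fun hd => hsd (h d hd)
  conv_lhs => rw [← divMonomial_add_modMonomial P s, hmod, add_zero]

/-- The monomial quotient of a `w`-homogeneous polynomial is `w`-homogeneous of the shifted weight (bookkeeping).
[cite: Lang2002, Ch. IV §1] -/
theorem isWeightedHomogeneous_divMonomial {w : ι → ℚ} {P : MvPolynomial ι k} {n : ℚ} (hP : IsWeightedHomogeneous w P n)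
    (s : ι →₀ ℕ) : IsWeightedHomogeneous w (P.divMonomial s) (n - Finsupp.weight w s) := by
  intro d hd
  rw [coeff_divMonomial] at hd
  have h := hP hd
  rw [map_add] at h
  rw [← h, add_sub_cancel_left]

/-- The monomial quotient involves only the variables of the polynomial (bookkeeping). [cite: Lang2002, Ch. IV §1] -/
theorem vars_divMonomial_subset [DecidableEq ι] (P : MvPolynomial ι k) (s : ι →₀ ℕ) : (P.divMonomial s).vars ⊆ P.vars := by
  intro j hj
  obtain ⟨d, hd, hjd⟩ := (mem_vars_iff_mem_support j).mp hj
  rw [mem_support_iff, coeff_divMonomial] at hd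
  refine (mem_vars_iff_mem_support j).mpr ⟨s + d, mem_support_iff.mpr hd, Finsupp.mem_support_iff.mpr ?_⟩
  rw [Finsupp.add_apply]
  exact (Nat.add_pos_right _ (Nat.pos_of_ne_zero (Finsupp.mem_support_iff.mp hjd))).ne'

/-- The support of the `λ`-component at level `λ_i + m` of a polynomial on a slot `i ∉ Z`: the monomials of the polynomial whose
`Z`-part has `λ'`-weight `m` (bookkeeping). [cite: GreuelPfister2002, Example 1.2.12] [cite: Lang2002, Ch. IV §1] -/
theorem mem_support_component_lamZ (Z : ι → Prop) [DecidablePred Z] (lam' : ι → ℕ) {i : ι} (hi : ¬ Z i) (m : ℚ)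
    (P : MvPolynomial ι k) (d : ι →₀ ℕ) :
    d ∈ (weightedHomogeneousComponent (lamZ Z lam') (lamZ Z lam' i + m) P).support ↔
      d ∈ P.support ∧ ((Finsupp.weight lam' (zpart Z d) : ℕ) : ℚ) = m := by
  classical
  rw [mem_support_iff, coeff_weightedHomogeneousComponent, lamZ_of_not Z lam' hi, zero_add, weight_lamZ, mem_support_iff]
  constructor
  · intro h
    split_ifs at h with hw
    · exact ⟨h, hw⟩
    · exact absurd rfl h
  · rintro ⟨h, hw⟩
    rwa [if_pos hw]

end Generic

/-! ## 3. Cancelling the substitution `T ↦ ε^γ T` -/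

section Cancel

/-- `P(ε^γ T) = Q(ε^γ T) ⟹ P = Q` for a non-zero-divisor `ε^γ` (bookkeeping over Mathlib's `comp_C_mul_X_eq_zero_iff`).
[cite: Lang2002, Ch. IV §1] -/
theorem comp_C_mul_X_injective {R : Type*} [CommRing R] {a : R} (ha : a ∈ nonZeroDivisors R) {P Q : Polynomial R}
    (h : P.comp (Polynomial.C a * Polynomial.X) = Q.comp (Polynomial.C a * Polynomial.X)) : P = Q := by
  rw [← sub_eq_zero, ← Polynomial.comp_C_mul_X_eq_zero_iff ha, Polynomial.sub_comp, h, sub_self]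

variable {k : Type*} [CommRing k] {ι : Type*} [Fintype ι] [DecidableEq ι]

/-- **`Φ₁(T) = Φ₂(ε^γ T)`** (engine, (L1′): "`Φ_λ(T)ε = Φ₂(ε^{γ₀}T)ε`"): if the data of `D₁` are `ε^γ` times those of `E`, `E`
kills the variables of a set `Z ⊇ supp γ`, and the tails `r₁ = ε^{pγ} r₂`, then the substitution of `(D₁, r₁)` is that of `(E, r₂)`
followed by `T ↦ ε^γ T` — by `D₁^b = ε^{bγ} E^b` (L9 (iii), `LeadingMonomial.iterate_eq_monomial_pow_mul_iterate`), coefficientwise.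
[cite: Matsumura1987, §25, §27 (pp. 207–209)] [cite: Lang2002, Ch. IV §1] -/
theorem substC_eq_comp_of_monomial_mul {D₁ E : Derivation k (MvPolynomial ι k) (MvPolynomial ι k)} {γ : ι →₀ ℕ} (Z : Set ι)
    (hγ : ∀ i ∈ γ.support, i ∈ Z) (hE : ∀ z ∈ Z, E (MvPolynomial.X z) = 0)
    (hD : ∀ i, D₁ (MvPolynomial.X i) = monomial γ 1 * E (MvPolynomial.X i)) (p : ℕ) (u : ℕ → k)
    {r₁ r₂ : ι → MvPolynomial ι k} (hr : ∀ i, r₁ i = monomial (p • γ) 1 * r₂ i) (P : MvPolynomial ι k) :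
    substC D₁ p u r₁ P = (substC E p u r₂ P).comp (Polynomial.C (monomial γ 1) * Polynomial.X) := by
  have key : (substC D₁ p u r₁ : MvPolynomial ι k →+* Polynomial (MvPolynomial ι k)) =
      (Polynomial.compRingHom (Polynomial.C (monomial γ 1) * Polynomial.X)).comp
        (substC E p u r₂ : MvPolynomial ι k →+* Polynomial (MvPolynomial ι k)) := by
    refine MvPolynomial.ringHom_ext (fun c => ?_) (fun i => ?_)
    · rw [RingHom.coe_coe, RingHom.comp_apply, RingHom.coe_coe, Polynomial.coe_compRingHom_apply, substC_C, substC_C,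
        Polynomial.C_comp]
    · rw [RingHom.coe_coe, RingHom.comp_apply, RingHom.coe_coe, Polynomial.coe_compRingHom_apply]
      refine Polynomial.ext fun n => ?_
      rw [Polynomial.comp_C_mul_X_coeff, coeff_substC_X, coeff_substC_X,
        LeadingMonomial.iterate_eq_monomial_pow_mul_iterate D₁ E Z hγ hE hD n (MvPolynomial.X i), hr i, monomial_pow, one_pow,
        add_mul]
      by_cases h1 : n < p
      · rw [if_pos h1, if_pos h1, if_neg h1.ne, if_neg h1.ne, add_zero, zero_mul, add_zero, smul_mul_assoc,
          mul_comm ((⇑E)^[n] (MvPolynomial.X i))]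
      · by_cases h2 : n = p
        · subst h2
          rw [if_neg h1, if_neg h1, if_pos rfl, if_pos rfl, zero_add, zero_mul, zero_add, mul_comm]
        · rw [if_neg h1, if_neg h1, if_neg h2, if_neg h2, add_zero, zero_mul, add_zero]
  have h := RingHom.congr_fun key P
  rwa [RingHom.coe_coe, RingHom.comp_apply, RingHom.coe_coe, Polynomial.coe_compRingHom_apply] at h

end Cancel

/-! ## 4. The derived flow: case (I) `𝔇_λ ≠ 0` (divide by `ε^{γ₀}`), case (II) `𝔇_λ = 0` (pure tails), and the generic weight -/

section DerivedFlow

variable {k : Type*} [Field k] {ι : Type*} [Fintype ι] [DecidableEq ι] {p : ℕ} {u : ℕ → k} {w : ι → ℚ} {θ : ℚ}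
  {G : MvPolynomial ι k} {D : Derivation k (MvPolynomial ι k) (MvPolynomial ι k)} {q : ι → MvPolynomial ι k}

/-- **CASE (I) of (L1′): the DIVIDED FLOW** (engine: `𝔇₂ := ε^{-γ₀} 𝔇_λ`, `q₂ := ε^{-pγ₀} q_λ`, unit `θ₂ = θ + ⟨w, γ₀⟩`).  If the
leading data `(𝔇_λ, q_λ)` of a tailed light flow on `G` (with `𝔇 = 0` below the threshold `c`) fix the face `G|_{Z″=0}`
(`Z″ = {w < c}`), every monomial of every `𝔇_λ ε_i` has `Z″`-part `γ₀ ⊆ Z″`, every monomial of every `q_{λ,i}` has `Z″`-part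
`p • γ₀`, and `𝔇_λ ≠ 0`, then the face carries a tailed light flow supported above `c`.
[cite: Matsumura1987, §25, §27 (pp. 207–209)] [cite: Lang2002, Ch. IV §1] -/
theorem exists_derived_flow_of_lead_ne_zero (F : IsTailedLightFlow p u w θ G D q) (hw : ∀ i, 0 ≤ w i) {c : ℚ}
    (hlow : ∀ i, w i < c → D (MvPolynomial.X i) = 0) {lam : ι → ℚ} {μ : ℚ}
    (hA : substC (lead lam D μ) p u (leadTail lam p q μ) (killLight (fun i => c ≤ w i) G)
      = Polynomial.C (killLight (fun i => c ≤ w i) G))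
    {γ : ι →₀ ℕ} (hγ : ∀ j ∈ γ.support, w j < c)
    (hdivD : ∀ i, ∀ d ∈ (lead lam D μ (MvPolynomial.X i)).support, zpart (fun j => w j < c) d = γ)
    (hdivq : ∀ i, ∀ d ∈ (leadTail lam p q μ i).support, zpart (fun j => w j < c) d = p • γ)
    (hne : ∃ i, lead lam D μ (MvPolynomial.X i) ≠ 0) :
    ∃ (θ' : ℚ) (D' : Derivation k (MvPolynomial ι k) (MvPolynomial ι k)) (q' : ι → MvPolynomial ι k),
      IsTailedLightFlow p u w θ' (killLight (fun i => c ≤ w i) G) D' q' ∧ SupportedAbove w c D' := by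
  classical
  set D' : Derivation k (MvPolynomial ι k) (MvPolynomial ι k) :=
    mkDerivation k fun i => (lead lam D μ (MvPolynomial.X i)).divMonomial γ with hD'def
  set q' : ι → MvPolynomial ι k := fun i => (leadTail lam p q μ i).divMonomial (p • γ) with hq'def
  have hD'X : ∀ i, D' (MvPolynomial.X i) = (weightedHomogeneousComponent lam (lam i + μ) (D (MvPolynomial.X i))).divMonomial γ :=
    fun i => by rw [hD'def, mkDerivation_X, lead_X]
  have hq'X : ∀ i, q' i = (weightedHomogeneousComponent lam (lam i + p • μ) (q i)).divMonomial (p • γ) := fun i => rfl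
  have hfacD : ∀ i, lead lam D μ (MvPolynomial.X i) = monomial γ 1 * D' (MvPolynomial.X i) := fun i => by
    rw [hD'X, ← lead_X]
    exact eq_monomial_mul_divMonomial fun d hd => by rw [← hdivD i d hd]; exact zpart_le _ d
  have hfacq : ∀ i, leadTail lam p q μ i = monomial (p • γ) 1 * q' i := fun i =>
    eq_monomial_mul_divMonomial fun d hd => by rw [← hdivq i d hd]; exact zpart_le _ d
  have hD'low : ∀ i, w i < c → D' (MvPolynomial.X i) = 0 := fun i hi => by
    rw [hD'X, hlow i hi, map_zero, zero_divMonomial]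
  have hfix : substC D' p u q' (killLight (fun i => c ≤ w i) G) = Polynomial.C (killLight (fun i => c ≤ w i) G) := by
    have hm : (monomial γ (1 : k)) ∈ nonZeroDivisors (MvPolynomial ι k) :=
      mem_nonZeroDivisors_of_ne_zero (monomial_eq_zero.not.mpr one_ne_zero)
    apply comp_C_mul_X_injective hm
    rw [← substC_eq_comp_of_monomial_mul {j | w j < c} hγ (fun z hz => hD'low z hz) hfacD p u hfacq, Polynomial.C_comp]
    exact hA
  refine ⟨θ + Finsupp.weight w γ, D', q', ⟨add_pos_of_pos_of_nonneg F.pos (LemmaXL.weight_nonneg hw γ), fun i => ?_,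
    fun i j hj => ?_, fun i hi => ?_, fun i => ?_, fun i j hj => ?_, fun i hi => ?_, hfix, ?_⟩, hD'low, fun i j hj => ?_⟩
  · -- weights of the divided data
    rw [hD'X]
    have h := isWeightedHomogeneous_divMonomial
      (isWeightedHomogeneous_weightedHomogeneousComponent_of (lam := lam) (F.wt_D i) (lam i + μ)) γ
    rwa [sub_sub] at h
  · -- variables of the divided data
    rw [hD'X] at hj
    exact F.vars_D i j (vars_weightedHomogeneousComponent_subset _ _ _ (vars_divMonomial_subset _ _ hj))
  · rw [hD'X, F.D_X_eq_zero i hi, map_zero, zero_divMonomial]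
  · -- weights of the divided tails
    rw [hq'X]
    have h := isWeightedHomogeneous_divMonomial
      (isWeightedHomogeneous_weightedHomogeneousComponent_of (lam := lam) (F.wt_q i) (lam i + p • μ)) (p • γ)
    rwa [map_nsmul, sub_sub, ← smul_add] at h
  · rw [hq'X] at hj
    exact F.vars_q i j (vars_weightedHomogeneousComponent_subset _ _ _ (vars_divMonomial_subset _ _ hj))
  · rw [hq'X, F.q_eq_zero i hi, map_zero, zero_divMonomial]
  · exact Or.inl (hne.imp fun i hi h0 => hi (by rw [hfacD i, h0, mul_zero]))
  · -- the divided data are free of `Z″`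
    obtain ⟨d, hd, hjd⟩ := (mem_vars_iff_mem_support j).mp hj
    have hd' : γ + d ∈ (lead lam D μ (MvPolynomial.X i)).support := by
      rw [mem_support_iff, ← coeff_divMonomial, lead_X, ← hD'X i]
      exact mem_support_iff.mp hd
    have hz : zpart (fun j => w j < c) d = 0 := by
      have h := hdivD i _ hd'
      rw [zpart_add, zpart_eq_self _ hγ] at h
      exact add_left_cancel (h.trans (add_zero γ).symm)
    exact not_lt.mp (not_of_zpart_eq_zero _ hz hjd)

omit [Fintype ι] in
/-- **CASE (II) of (L1′): the PURE-TAIL FLOW** (engine: "`𝔇_λ = 0` ⇒ the leading tails alone fix the face").  If the leading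
derivation vanishes, `(0, q_λ)` is a tailed light flow of unit `θ` on the face `G|_{Z″=0}`, trivially supported above `c`.
[cite: Matsumura1987, §27 (pp. 207–209)] [cite: Lang2002, Ch. IV §1] -/
theorem exists_derived_flow_of_lead_eq_zero (F : IsTailedLightFlow p u w θ G D q) {c : ℚ} {lam : ι → ℚ} {μ : ℚ}
    (hA : substC (lead lam D μ) p u (leadTail lam p q μ) (killLight (fun i => c ≤ w i) G)
      = Polynomial.C (killLight (fun i => c ≤ w i) G))
    (hlead : ∀ i, lead lam D μ (MvPolynomial.X i) = 0) (hne : ∃ i, leadTail lam p q μ i ≠ 0) :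
    ∃ (θ' : ℚ) (D' : Derivation k (MvPolynomial ι k) (MvPolynomial ι k)) (q' : ι → MvPolynomial ι k),
      IsTailedLightFlow p u w θ' (killLight (fun i => c ≤ w i) G) D' q' ∧ SupportedAbove w c D' := by
  have h0 : lead lam D μ = 0 := derivation_ext fun i => by rw [hlead i, Derivation.zero_apply]
  rw [h0] at hA
  refine ⟨θ, 0, leadTail lam p q μ, ⟨F.pos, fun i => ?_, fun i j hj => ?_, fun i _ => Derivation.zero_apply _, fun i => ?_,
    fun i j hj => ?_, fun i hi => ?_, hA, Or.inr hne⟩, fun i _ => Derivation.zero_apply _, fun i j hj => ?_⟩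
  · rw [Derivation.zero_apply]
    exact isWeightedHomogeneous_zero k w _
  · rw [Derivation.zero_apply, vars_0] at hj
    exact absurd hj (Finset.notMem_empty j)
  · exact isWeightedHomogeneous_weightedHomogeneousComponent_of (F.wt_q i) (lam i + p • μ)
  · exact F.vars_q i j (vars_weightedHomogeneousComponent_subset lam (lam i + p • μ) (q i) hj)
  · rw [leadTail, F.q_eq_zero i hi, map_zero]
  · rw [Derivation.zero_apply, vars_0] at hj
    exact absurd hj (Finset.notMem_empty j)

/-- **STEP (L1′): THE DERIVED FLOW** (RE-DERIVATION-eng1-g44 §3.3, CARVER-NOTES-eng1-g45 §1–§3; statement engine 1's, proof OURS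
following the engine).  A tailed light flow of unit `θ` on `G` whose derivation vanishes below a threshold `c ≤ p` induces on the
face `G|_{Z″=0}` (`Z″ = {w < c}`) a tailed light flow of some unit, supported above `c`: generic weight on the `Z″`-parts
(`GenericWeight.exists_generic_weight`), the level `μ`, the leading-form principle (★′) (`substC_lead_component_zero`), then case
(I) (`exists_derived_flow_of_lead_ne_zero`) or case (II) (`exists_derived_flow_of_lead_eq_zero`).
[cite: Matsumura1987, §25, §27 (pp. 207–209)] [cite: Lang2002, Ch. IV §1] [cite: GreuelPfister2002, Lemma 1.2.11, Example 1.2.12] -/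
theorem exists_derived_flow (F : IsTailedLightFlow p u w θ G D q) (hp : 0 < p) (hw : ∀ i, 0 ≤ w i) {c : ℚ} (hcp : c ≤ p)
    (hlow : ∀ i, w i < c → D (MvPolynomial.X i) = 0) :
    ∃ (θ' : ℚ) (D' : Derivation k (MvPolynomial ι k) (MvPolynomial ι k)) (q' : ι → MvPolynomial ι k),
      IsTailedLightFlow p u w θ' (killLight (fun i => c ≤ w i) G) D' q' ∧ SupportedAbove w c D' := by
  classical
  -- light slots below `c` carry no tail either
  have hqlow : ∀ i, w i < c → q i = 0 := fun i hi => F.q_eq_zero i (Or.inl (lt_of_lt_of_le hi hcp))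
  -- the `Z″`-parts of the exponents of the data and of the tails
  set E_D : Finset (ι →₀ ℕ) := Finset.univ.biUnion fun i => (D (MvPolynomial.X i)).support.image (zpart fun j => w j < c)
    with hE_D
  set E_q : Finset (ι →₀ ℕ) := Finset.univ.biUnion fun i => (q i).support.image (zpart fun j => w j < c) with hE_q
  have hED : ∀ i, ∀ d ∈ (D (MvPolynomial.X i)).support, zpart (fun j => w j < c) d ∈ E_D := fun i d hd =>
    Finset.mem_biUnion.mpr ⟨i, Finset.mem_univ i, Finset.mem_image_of_mem _ hd⟩
  have hEq : ∀ i, ∀ d ∈ (q i).support, zpart (fun j => w j < c) d ∈ E_q := fun i d hd =>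
    Finset.mem_biUnion.mpr ⟨i, Finset.mem_univ i, Finset.mem_image_of_mem _ hd⟩
  -- a generic positive weight on the `Z″`-parts
  obtain ⟨lam', hpos, hinjD, hinjq, hsep⟩ := GenericWeight.exists_generic_weight E_D E_q p
  set lam : ι → ℚ := lamZ (fun j => w j < c) lam' with hlam
  have hlamnn : ∀ i, 0 ≤ lam i := lamZ_nonneg _ lam'
  have hH : ∀ i, c ≤ w i ↔ lam i = 0 := fun i => by rw [hlam, lamZ_eq_zero_iff _ lam' hpos, not_lt]
  -- the level `μ`
  set S : Finset ℚ := E_D.image (fun e => ((Finsupp.weight lam' e : ℕ) : ℚ)) ∪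
    E_q.image (fun e => ((Finsupp.weight lam' e : ℕ) : ℚ) / p) with hS
  have hpQ : (0 : ℚ) < p := Nat.cast_pos.mpr hp
  have hSne : S.Nonempty := by
    rcases F.ne_zero with ⟨i, hi⟩ | ⟨i, hi⟩
    · obtain ⟨d, hd⟩ := Finset.nonempty_iff_ne_empty.mpr (support_eq_empty.not.mpr hi)
      exact ⟨_, Finset.mem_union_left _ (Finset.mem_image_of_mem _ (hED i d hd))⟩
    · obtain ⟨d, hd⟩ := Finset.nonempty_iff_ne_empty.mpr (support_eq_empty.not.mpr hi)
      exact ⟨_, Finset.mem_union_right _ (Finset.mem_image_of_mem _ (hEq i d hd))⟩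
  set μ : ℚ := S.min' hSne with hμ
  have hμD : ∀ e ∈ E_D, μ ≤ ((Finsupp.weight lam' e : ℕ) : ℚ) := fun e he =>
    Finset.min'_le S _ (Finset.mem_union_left _ (Finset.mem_image_of_mem _ he))
  have hμq : ∀ e ∈ E_q, p • μ ≤ ((Finsupp.weight lam' e : ℕ) : ℚ) := fun e he => by
    rw [nsmul_eq_mul, mul_comm]
    exact (le_div_iff₀ hpQ).mp (Finset.min'_le S _ (Finset.mem_union_right _ (Finset.mem_image_of_mem _ he)))
  -- the filtration hypotheses of (★′)
  have hDwt : ∀ i, WtGE lam (lam i + μ) (D (MvPolynomial.X i)) := by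
    intro i d hd
    by_cases hi : w i < c
    · rw [hlow i hi, support_zero] at hd
      exact absurd hd (Finset.notMem_empty d)
    · rw [hlam, lamZ_of_not _ lam' hi, zero_add, weight_lamZ]
      exact hμD _ (hED i d hd)
  have hqwt : ∀ i, WtGE lam (lam i + p • μ) (q i) := by
    intro i d hd
    by_cases hi : w i < c
    · rw [hqlow i hi, support_zero] at hd
      exact absurd hd (Finset.notMem_empty d)
    · rw [hlam, lamZ_of_not _ lam' hi, zero_add, weight_lamZ]
      exact hμq _ (hEq i d hd)
  -- (★′): the leading data fix the face
  have hA := substC_lead_component_zero lam D p u q μ hlamnn hDwt hqwt F.fix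
  rw [weightedHomogeneousComponent_zero_eq_killLight lam hlamnn (fun i => c ≤ w i) hH] at hA
  -- the supports of the leading data and tails
  have hleadD : ∀ i d, d ∈ (lead lam D μ (MvPolynomial.X i)).support →
      d ∈ (D (MvPolynomial.X i)).support ∧ ((Finsupp.weight lam' (zpart (fun j => w j < c) d) : ℕ) : ℚ) = μ := by
    intro i d hd
    have hi : ¬ w i < c := fun hi => by
      rw [lead_X, hlow i hi, map_zero, support_zero] at hd
      exact Finset.notMem_empty d hd
    rw [lead_X, hlam] at hd
    exact (mem_support_component_lamZ _ lam' hi μ _ d).mp hd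
  have hleadq : ∀ i d, d ∈ (leadTail lam p q μ i).support →
      d ∈ (q i).support ∧ ((Finsupp.weight lam' (zpart (fun j => w j < c) d) : ℕ) : ℚ) = p • μ := by
    intro i d hd
    have hi : ¬ w i < c := fun hi => by
      rw [leadTail, hqlow i hi, map_zero, support_zero] at hd
      exact Finset.notMem_empty d hd
    rw [leadTail, hlam] at hd
    exact (mem_support_component_lamZ _ lam' hi (p • μ) _ d).mp hd
  by_cases hcase : ∃ i, lead lam D μ (MvPolynomial.X i) ≠ 0
  · -- CASE (I): `𝔇_λ ≠ 0`; `γ₀ :=` the common `Z″`-part of the leading data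
    obtain ⟨i₀, hi₀⟩ := hcase
    obtain ⟨d₀, hd₀⟩ := Finset.nonempty_iff_ne_empty.mpr (support_eq_empty.not.mpr hi₀)
    obtain ⟨hd₀D, hd₀μ⟩ := hleadD i₀ d₀ hd₀
    have hγE : zpart (fun j => w j < c) d₀ ∈ E_D := hED i₀ d₀ hd₀D
    refine exists_derived_flow_of_lead_ne_zero F hw hlow hA (γ := zpart (fun j => w j < c) d₀)
      (fun j hj => ((mem_support_zpart _).mp hj).2) (fun i d hd => ?_) (fun i d hd => ?_) ⟨i₀, hi₀⟩
    · obtain ⟨hdD, hdμ⟩ := hleadD i d hd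
      exact GenericWeight.eq_of_weight_eq hinjD (hED i d hdD) hγE (by exact_mod_cast hdμ.trans hd₀μ.symm)
    · obtain ⟨hdq, hdμ⟩ := hleadq i d hd
      refine (hsep _ hγE _ (hEq i d hdq) ?_).symm
      have h : ((Finsupp.weight lam' (p • zpart (fun j => w j < c) d₀) : ℕ) : ℚ)
          = ((Finsupp.weight lam' (zpart (fun j => w j < c) d) : ℕ) : ℚ) := by
        rw [GenericWeight.weight_nsmul, Nat.cast_mul, hd₀μ, hdμ, nsmul_eq_mul]
      exact_mod_cast h
  · -- CASE (II): `𝔇_λ = 0`; the level is attained by a tail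
    push Not at hcase
    rcases Finset.mem_union.mp (Finset.min'_mem S hSne) with hμ1 | hμ2
    · exfalso
      obtain ⟨e, he, hval⟩ := Finset.mem_image.mp hμ1
      obtain ⟨i, -, hi⟩ := Finset.mem_biUnion.mp he
      obtain ⟨d, hd, rfl⟩ := Finset.mem_image.mp hi
      have hi' : ¬ w i < c := fun hZ => by
        rw [hlow i hZ, support_zero] at hd
        exact Finset.notMem_empty d hd
      have hmem : d ∈ (lead lam D μ (MvPolynomial.X i)).support := by
        rw [lead_X, hlam]
        exact (mem_support_component_lamZ _ lam' hi' μ _ d).mpr ⟨hd, hval⟩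
      rw [hcase i, support_zero] at hmem
      exact Finset.notMem_empty d hmem
    · obtain ⟨e, he, hval⟩ := Finset.mem_image.mp hμ2
      obtain ⟨i, -, hi⟩ := Finset.mem_biUnion.mp he
      obtain ⟨d, hd, rfl⟩ := Finset.mem_image.mp hi
      have hi' : ¬ w i < c := fun hZ => by
        rw [hqlow i hZ, support_zero] at hd
        exact Finset.notMem_empty d hd
      refine exists_derived_flow_of_lead_eq_zero F hA hcase ⟨i, fun h0 => ?_⟩
      have hmem : d ∈ (leadTail lam p q μ i).support := by
        rw [leadTail, hlam]
        refine (mem_support_component_lamZ _ lam' hi' (p • μ) _ d).mpr ⟨hd, ?_⟩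
        rw [hμ, ← hval, nsmul_eq_mul, mul_div_cancel₀ _ hpQ.ne']
      rw [h0, support_zero] at hmem
      exact Finset.notMem_empty d hmem

end DerivedFlow

/-! ## 5. (L1′) as the typed `DerivedFaceStep`, and THEOREM 𝔉′ unconditionally -/

section TheoremFPrime

open Truncation
open scoped Nat

variable {k : Type*} [Field k] {ι : Type*} [Fintype ι] [DecidableEq ι] {p : ℕ} {u : ℕ → k} {w : ι → ℚ} {h : MvPolynomial ι k}

/-- **STEP (L1′) IN THE TYPED FORM THE INDUCTION CONSUMES** (`DerivedFaceStep p u w h` of the tree's THEOREM 𝔉′ frame; ours): for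
`1 < p` and positive weights, a tailed light flow on a face `face_c h` with lowest moved light slot `y` yields a tailed light flow
on `face_{w_y} h` supported above `w_y` (`exists_derived_flow` at the threshold `w_y`, nested faces `face_face_of_le`).
[cite: Matsumura1987, §27 (pp. 207–209)] [cite: Lang2002, Ch. IV §1] [cite: AbramovichTemkinWlodarczyk2024, §5.1 (p. 1575)] -/
theorem derivedFaceStep (hp : 1 < p) (hw : ∀ i, 0 < w i) : DerivedFaceStep p u w h := by
  intro c θ D q y j F hcy hyp hlow _
  obtain ⟨θ', D', q', F', hS'⟩ := exists_derived_flow F (zero_lt_one.trans hp) (fun i => (hw i).le) hyp.le hlow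
  refine ⟨θ', D', q', ?_, hS'⟩
  rw [← face_eq, face_face_of_le w hcy] at F'
  exact F'

/-- **THEOREM 𝔉′ (engine 1's `W(f)` toy model), UNCONDITIONALLY**: under `b!·u_b = 1 (b < p)`, `1 < p`, positive weights and the
pin condition (P) (`SlotPinned`) at every slot of weight `≤ p + 1`, the menu `h` carries NO tailed light flow of any unit —
the tree's induction `noTailedLightFlow_of_derivedFaceStep` ((H′), (L0′) from the tree) fed with step (L1′) (`derivedFaceStep`).
An instrument for the toy model, NOT a resolution theorem.
[cite: Matsumura1987, §27 (pp. 207–209)] [cite: AbramovichTemkinWlodarczyk2024, §5.1 (p. 1575), Thm. 5.3.1 (2)-(3) (p. 1578)] -/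
theorem noTailedLightFlow (hu : ∀ n < p, ((n ! : ℕ) : k) * u n = 1) (hp : 1 < p) (hw : ∀ i, 0 < w i)
    (hP : ∀ l, w l ≤ (p : ℚ) + 1 → SlotPinned w l h) : NoTailedLightFlow p u w h :=
  noTailedLightFlow_of_derivedFaceStep hu hp hw hP (derivedFaceStep hp hw)

end TheoremFPrime

end TailedLightFlow

end Literature.AlgebraicGeometry.Resolution.WeightedBlowup
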